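import Summits.SmoothPoincare4.SmoothPoincare4.Theses.WeakReductionDescent
import Literature.Topology.FourManifolds.SphereTrisectionsSectors
import Literature.Topology.FourManifolds.TrisectionFunctorGKNaturality
import Literature.Topology.FourManifolds.WeaklyReducibleTrisections
import Summits.SmoothPoincare4.SmoothPoincare4.Theorems.WeakReductionReduces.Negative.RefutationCost

/-!
# `MinimalWeaklyReducibleFromFour` — negative-side support: refutation cost, counterexample sector,
# and the strongest variant (crux stmt-SmoothPoincare4-18019, cdisprove seat)

Crux X₂ `WeakReductionDescent.MinimalWeaklyReducibleFromFour` (K1 verbatim for `4 ≤ g`): for every smooth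
homotopy 4-sphere `M` (the Statement's bare binders + `e : M ≃ₕ S⁴`) and every Gay–Kirby trisection `T` of
genus `g ≥ 4` that is of MINIMAL genus for `M`, `T` is weakly reducible (Aranda–Zupan: disjoint
non-separating curves `c`, `c′` on the central surface, `c` compressing in one handlebody of the spine,
`c′` in the other two).

* `not_smoothPoincare4_of_not_minimalWeaklyReducibleFromFour` — REFUTATION COST: `¬ X₂ → ¬ SmoothPoincare4`.
  The round `S⁴` carries Gay–Kirby's genus-`0` trisection
  (`Literature.Topology.FourManifolds.sphere_genusZero_gkTrisection_holds`, proved) and trisections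
  transport along diffeomorphisms (`IsGKTrisection.image_diffeomorph'`, proved), so under the summit no
  trisection of genus `≥ 1` of a homotopy sphere is minimal and X₂ holds by VACUITY (first observed in the
  birth attack `Cruxes/MinimalWeaklyReducibleFromFour/BirthAttack.lean`, refuter-rattack-…-18019-0; the
  two transport lemmas are imported from the sibling crux's landed
  `Theorems/WeakReductionReduces/Negative/RefutationCost.lean`).  No finite, degenerate or junk model
  can kill the crux.
* `exotic_of_not_minimalWeaklyReducibleFromFour` — THE COUNTEREXAMPLE SECTOR: a refutation is a smooth
  homotopy 4-sphere admitting no diffeomorphism to the round `S⁴`, carrying a minimal GK-trisection of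
  genus `≥ 4` that is NOT weakly reducible (strongly irreducible in Aranda–Zupan's sense,
  `¬ Trisection.IsWeaklyReducible T`).
* `not_minimalWeaklyReducible_of_not_minimalWeaklyReducibleFromFour` — the parent crux K1
  (`MinimalWeaklyReducible`, threshold `3 ≤ g`) breaks with its piece X₂.
* `not_noMinimalFromFour_of_not_minimalWeaklyReducibleFromFour` — THE STRONGEST VARIANT: "no smooth
  homotopy 4-sphere has a minimal GK-trisection of genus `≥ 4`" (stated inline; itself SPC4-implied,
  `noMinimalFromFour_of_smoothPoincare4`) implies X₂ and every mutation of X₂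
  that keeps (`e`, `4 ≤ g`, minimal): the weak-reduction vocabulary carries the route's METHOD at `g ≥ 4`,
  not truth value modulo the summit.  The hypotheses that carry truth value are `e` and MINIMALITY; the
  picked line `Sketch` (spine KCap, apex `stub_sectorHaken`) discards minimality and is analysed in the
  sibling file `Negative/SectorHakenCost.lean` and in the crux work file
  `Cruxes/MinimalWeaklyReducibleFromFour/Disproof.lean`.
-/

noncomputable section

-- the prescribed namespace `Summit.<P>.<Sub>.…` duplicates `SmoothPoincare4` (P = Sub)
set_option linter.dupNamespace false

open scoped Manifold ContDiff Topology ContinuousMap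
open Set
open Literature.Topology.FourManifolds
open Summit.SmoothPoincare4.SmoothPoincare4.Theses.WeakReductionDescent

namespace Summit.SmoothPoincare4.SmoothPoincare4.Theorems.MinimalWeaklyReducibleFromFour.Negative

-- `not_minimal_of_diffeomorph` / `not_minimal_of_smoothPoincare4` (a diffeomorphism to the round sphere
-- pulls Gay–Kirby's genus-`0` trisection back, so no GK-trisection of genus `≥ 1` is minimal) are the
-- landed lemmas of the sibling crux's `Theorems/WeakReductionReduces/Negative/RefutationCost.lean`.
open Summit.SmoothPoincare4.SmoothPoincare4.Theorems.WeakReductionReduces.Negative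
  (not_minimal_of_diffeomorph not_minimal_of_smoothPoincare4)

/-- **Refutation cost of the crux.** `¬ MinimalWeaklyReducibleFromFour → ¬ SmoothPoincare4`: the summit
makes every homotopy 4-sphere standard, hence without minimal trisections of genus `≥ 4`, so X₂ holds
vacuously under it; killing X₂ kills the summit. [folklore] -/
theorem not_smoothPoincare4_of_not_minimalWeaklyReducibleFromFour (h : ¬ MinimalWeaklyReducibleFromFour) :
    ¬ _root_.SmoothPoincare4 := by
  intro hs
  refine h ?_
  intro M _ _ _ _ _ e g k T _hT hg hmin
  exact (not_minimal_of_smoothPoincare4 hs e (by omega) hmin).elim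

/-- **The parent crux breaks with its piece**: X₂ is K1 (`MinimalWeaklyReducible`, threshold `3 ≤ g`)
restricted to `4 ≤ g`, so `¬ X₂ → ¬ K1`. [folklore] -/
theorem not_minimalWeaklyReducible_of_not_minimalWeaklyReducibleFromFour
    (h : ¬ MinimalWeaklyReducibleFromFour) : ¬ MinimalWeaklyReducible := by
  intro h1
  refine h ?_
  intro M _ _ _ _ _ e g k T hT hg hmin
  exact h1 M e g k T hT (by omega) hmin

/-- **The counterexample sector.** A refutation of X₂ is a smooth homotopy 4-sphere carrying a
GK-trisection of genus `≥ 4` that is minimal and NOT weakly reducible (a strongly irreducible minimal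
trisection, Aranda–Zupan arXiv:2503.04607 Question 8.3 one genus up and for a MINIMAL trisection); such an
`M` admits no diffeomorphism to the round `S⁴` — an exotic 4-sphere of trisection genus `≥ 4`. [folklore] -/
theorem exotic_of_not_minimalWeaklyReducibleFromFour (h : ¬ MinimalWeaklyReducibleFromFour) :
    ∃ (M : Type) (_ : TopologicalSpace M) (_ : T2Space M) (_ : SecondCountableTopology M)
      (_ : ChartedSpace (EuclideanSpace ℝ (Fin 4)) M) (_ : IsManifold (𝓡 4) ∞ M),
      Nonempty (M ≃ₕ (Metric.sphere (0 : EuclideanSpace ℝ (Fin 5)) 1)) ∧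
      (∃ (g : ℕ) (k : Fin 3 → ℕ) (T : Fin 3 → Set M), IsGKTrisection M g k T ∧ 4 ≤ g ∧
        (∀ (g' : ℕ) (k' : Fin 3 → ℕ) (T' : Fin 3 → Set M), IsGKTrisection M g' k' T' → g ≤ g') ∧
        ¬ Trisection.IsWeaklyReducible T) ∧
      IsEmpty (M ≃ₘ⟮𝓡 4, 𝓡 4⟯ (Metric.sphere (0 : EuclideanSpace ℝ (Fin 5)) 1)) := by
  by_contra hcon
  refine h ?_
  intro M _ _ _ _ _ e g k T hT hg hmin
  by_contra hwr
  exact hcon ⟨M, ‹_›, ‹_›, ‹_›, ‹_›, ‹_›, ⟨e⟩, ⟨g, k, T, hT, hg, hmin,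
    fun h' => hwr ((Trisection.isWeaklyReducible_iff T).1 h')⟩,
    ⟨fun Φ => not_minimal_of_diffeomorph Φ (le_trans (by norm_num) hg) hmin⟩⟩

/-- **Sandwich.** `¬ X₂` refutes the strongest variant "no smooth homotopy 4-sphere has a minimal
GK-trisection of genus `≥ 4`" (the variant implies X₂ trivially, as it implies every statement with the
hypotheses `e`, `4 ≤ g`, minimal). [folklore] -/
theorem not_noMinimalFromFour_of_not_minimalWeaklyReducibleFromFour (h : ¬ MinimalWeaklyReducibleFromFour) :
    ¬ (∀ (M : Type) [TopologicalSpace M] [T2Space M] [SecondCountableTopology M]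
        [ChartedSpace (EuclideanSpace ℝ (Fin 4)) M] [IsManifold (𝓡 4) ∞ M],
        (M ≃ₕ (Metric.sphere (0 : EuclideanSpace ℝ (Fin 5)) 1)) → ∀ (g : ℕ) (k : Fin 3 → ℕ) (T : Fin 3 → Set M), IsGKTrisection M g k T → 4 ≤ g →
          ¬ ∀ (g' : ℕ) (k' : Fin 3 → ℕ) (T' : Fin 3 → Set M), IsGKTrisection M g' k' T' → g ≤ g') := by
  intro hNo
  refine h ?_
  intro M _ _ _ _ _ e g k T hT hg hmin
  exact (hNo M e g k T hT hg hmin).elim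

/-- **The strongest variant is itself SPC4-implied** (so the whole sandwich
`NoMinimalFromFour → X₂`, `SmoothPoincare4 → NoMinimalFromFour` lives under the summit). [folklore] -/
theorem noMinimalFromFour_of_smoothPoincare4 (hs : _root_.SmoothPoincare4) :
    ∀ (M : Type) [TopologicalSpace M] [T2Space M] [SecondCountableTopology M]
        [ChartedSpace (EuclideanSpace ℝ (Fin 4)) M] [IsManifold (𝓡 4) ∞ M],
        (M ≃ₕ (Metric.sphere (0 : EuclideanSpace ℝ (Fin 5)) 1)) → ∀ (g : ℕ) (k : Fin 3 → ℕ) (T : Fin 3 → Set M), IsGKTrisection M g k T → 4 ≤ g →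
          ¬ ∀ (g' : ℕ) (k' : Fin 3 → ℕ) (T' : Fin 3 → Set M), IsGKTrisection M g' k' T' → g ≤ g' := by
  intro M _ _ _ _ _ e g k T _hT hg hmin
  exact not_minimal_of_smoothPoincare4 hs e (by omega) hmin

/-- **On the round sphere the crux binds nothing**: for `M = S⁴` itself (and every `M` diffeomorphic to
it) the hypothesis "minimal of genus `g ≥ 1`" is false, whatever the trisection. Contrast with the picked
line's apex `stub_sectorHaken`, whose hypotheses ARE satisfiable on the round sphere
(`Negative/SectorHakenCost.lean`). [folklore] -/
theorem sphere_not_minimal {g : ℕ} (hg : 1 ≤ g)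
    (hmin : ∀ (g' : ℕ) (k' : Fin 3 → ℕ) (T' : Fin 3 → Set (Metric.sphere (0 : EuclideanSpace ℝ (Fin 5)) 1)),
      IsGKTrisection (Metric.sphere (0 : EuclideanSpace ℝ (Fin 5)) 1) g' k' T' → g ≤ g') : False :=
  not_minimal_of_diffeomorph (Diffeomorph.refl (𝓡 4) (Metric.sphere (0 : EuclideanSpace ℝ (Fin 5)) 1) ∞) hg hmin

end Summit.SmoothPoincare4.SmoothPoincare4.Theorems.MinimalWeaklyReducibleFromFour.Negative

end
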